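import Summits.CriticalPhenomena.CardyFormulaZ2.Theorems.CardyIKTransportCornerLineDescentDiluteInfluenceReduction

/-!
# Stub `stub_SummedInfluence` (line `symmetric-seed-second-order`, crux `CardyIKTransport.CornerLineDescent`,
# stmt-CriticalPhenomena-10964): the dense-regime summed-influence bound REDUCED to a per-face estimate

Vocabulary: `Theorems/CardyIKTransportCornerLineDescentLine.lean` (`influence p R δ f`, `influenceSum p R δ`,
`InfluenceBoundOn`, `SyndromeBiasAt`, `pIK`).  The bookkeeping of the `stub_DiluteInfluence` groundwork
(`…DiluteInfluenceZeros.lean`: faces of non-zero influence are splitting faces, at EVERY density `p`;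
`…DiluteInfluenceReduction.lean`: they number `≤ (2M+1)² δ⁻²`, `influenceSum_le_of_bulk_and_layer`) applies
verbatim in the dense regime `c₀ δ ≤ p ≤ p_IK` of the lead's stub `stub_SummedInfluence`, whose target is
`Σ_f |I_f(p)| ≤ C p⁻¹ (δ/p)^θ` (`InfluenceBoundOn`).  Proved here: the general two-tier bookkeeping
`influenceSum_le_card_mul_add` (any bulk / layer bounds and counts), and `influenceBoundOn_of_bulk_and_layer_bound`
— it suffices that, eventually in `δ`, off an exceptional set `E_δ` of `≤ C δ⁻¹` faces every face has
`|I_f(p)| ≤ C p⁻¹ (δ/p)^θ · δ²` (BULK: the per-face share of the target) and on `E_δ` every face has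
`|I_f(p)| ≤ C p⁻¹ (δ/p)^θ · δ` (LAYER), for all `c₀ δ ≤ p ≤ p_IK` — with the registered anchor
`stub_SummedInfluence_of_bulk_and_layer_bound`: that hypothesis implies the stub as registered (its antecedent
`SyndromeBiasAt` is then not even needed: it is the tool by which the per-face estimate is to be proved).

What is NOT here: the per-face estimate (card U2: zero four-arm amplitude of the symmetric seed plus a memory rate;
the load-bearing open claim of the line).
-/

noncomputable section

namespace Summit.CriticalPhenomena.CardyFormulaZ2.Theorems.CornerLineDescent.SymmetricSeed

open scoped BigOperators Topology Classical MeasureTheory ProbabilityTheory ENNReal NNReal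
open Filter Set Function MeasureTheory
open Literature.Probability.Percolation (sitePercolation bondPercolation half BondConfig embDomainCrossing rectangle)
open Literature.Probability.LatticeModels
open Literature.Probability.RandomPlanarGeometry

/-! ## §F The dense regime: `InfluenceBoundOn` from a per-face bulk + layer estimate -/

/-- GENERAL TWO-TIER BOOKKEEPING (every density `p`, any counts): if `R.carrier ⊆ B(0, M)`, `0 < δ`, every face
off the finite set `E` has `|I_f(p)| ≤ b` and every face of `E` has `|I_f(p)| ≤ ℓ` (`b, ℓ ≥ 0`), then
`Σ_f |I_f(p)| ≤ #latticeBox ⌊M/δ⌋₊ · b + #E · ℓ` — only the faces of the box contribute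
(`influenceSum_eq_sum_latticeBox`); combine with `card_latticeBox_floor_le`
(`#latticeBox ⌊M/δ⌋₊ ≤ (2M+1)² δ⁻²` for `0 < δ < 1`). [folklore] -/
theorem influenceSum_le_card_mul_add {R : ConformalRectangle} {δ M b ℓ : ℝ} {p : ℝ} {E : Finset (Site 2)}
    (hδ0 : 0 < δ) (hM : ∀ z ∈ R.carrier, ‖z‖ ≤ M) (hb : 0 ≤ b) (hℓ : 0 ≤ ℓ)
    (hbulk : ∀ f ∉ E, |influence p R δ f| ≤ b) (hlayer : ∀ f ∈ E, |influence p R δ f| ≤ ℓ) :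
    influenceSum p R δ ≤ ((latticeBox ⌊M / δ⌋₊).card : ℝ) * b + (E.card : ℝ) * ℓ := by
  set B := latticeBox ⌊M / δ⌋₊ with hB
  rw [influenceSum_eq_sum_latticeBox hδ0 hM p, ← hB,
    ← Finset.sum_sdiff (Finset.inter_subset_left (s₁ := B) (s₂ := E))]
  refine add_le_add ((Finset.sum_le_card_nsmul _ _ b fun f hf => ?_).trans ?_)
    ((Finset.sum_le_card_nsmul _ _ ℓ fun f hf => hlayer f (Finset.mem_inter.1 hf).2).trans ?_)
  · rw [Finset.mem_sdiff, Finset.mem_inter, not_and] at hf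
    exact hbulk f (hf.2 hf.1)
  · rw [nsmul_eq_mul]
    exact mul_le_mul_of_nonneg_right (by exact_mod_cast Finset.card_le_card Finset.sdiff_subset) hb
  · rw [nsmul_eq_mul]
    exact mul_le_mul_of_nonneg_right (by exact_mod_cast Finset.card_le_card Finset.inter_subset_right) hℓ

/-- DENSE-REGIME REDUCTION.  If for the conformal rectangle `R` there are `θ > 0`, `C`, `c₀ > 0` such that,
eventually as `δ → 0⁺`, an exceptional set `E_δ` of at most `C δ⁻¹` faces exists with, for every density
`c₀ δ ≤ p ≤ p_IK`, `|I_f(p)| ≤ C p⁻¹ (δ/p)^θ δ²` off `E_δ` and `|I_f(p)| ≤ C p⁻¹ (δ/p)^θ δ` on `E_δ`, then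
`InfluenceBoundOn R θ C' c₀ δ` eventually, `C' = ((2M+1)² + C) C` for `R.carrier ⊆ B(0, M)`: only the
`≤ (2M+1)² δ⁻²` faces of `latticeBox ⌊M/δ⌋₊` have non-zero influence (`influenceSum_le_of_bulk_and_layer` with
`K = C p⁻¹ (δ/p)^θ ≥ 0`, as `p ≥ c₀ δ > 0`). [folklore] -/
theorem influenceBoundOn_of_bulk_and_layer_bound (R : ConformalRectangle)
    (h : ∃ θ C c₀ : ℝ, 0 < θ ∧ 0 < c₀ ∧ ∀ᶠ δ in 𝓝[>] (0:ℝ), ∃ E : Finset (Site 2),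
      (E.card : ℝ) ≤ C * δ⁻¹ ∧ ∀ p : ℝ, c₀ * δ ≤ p → p ≤ pIK → ∀ f : Site 2,
        (f ∉ E → |influence p R δ f| ≤ C * p⁻¹ * (δ / p) ^ θ * δ ^ 2) ∧
          (f ∈ E → |influence p R δ f| ≤ C * p⁻¹ * (δ / p) ^ θ * δ)) :
    ∃ θ C c₀ : ℝ, 0 < θ ∧ 0 < c₀ ∧ ∀ᶠ δ in 𝓝[>] (0:ℝ), InfluenceBoundOn R θ C c₀ δ := by
  obtain ⟨θ, C, c₀, hθ, hc₀, hev⟩ := h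
  obtain ⟨M, hMpos, hM⟩ := R.isBounded.exists_pos_norm_le
  refine ⟨θ, ((2 * M + 1) ^ 2 + C) * C, c₀, hθ, hc₀, ?_⟩
  filter_upwards [hev, Ioo_mem_nhdsGT zero_lt_one] with δ hδ hδ01
  obtain ⟨E, hEcard, hδ⟩ := hδ
  intro p hpl hpu
  have hδ0 : 0 < δ := hδ01.1
  have hp : 0 < p := lt_of_lt_of_le (mul_pos hc₀ hδ0) hpl
  have hC : 0 ≤ C := by
    have h1 : (0:ℝ) ≤ C * δ⁻¹ := le_trans (Nat.cast_nonneg _) hEcard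
    exact nonneg_of_mul_nonneg_left h1 (inv_pos.2 hδ0)
  have hK : 0 ≤ C * p⁻¹ * (δ / p) ^ θ :=
    mul_nonneg (mul_nonneg hC (inv_nonneg.2 hp.le)) (Real.rpow_nonneg (div_nonneg hδ0.le hp.le) _)
  refine (influenceSum_le_of_bulk_and_layer hδ0 hδ01.2 hMpos.le hM hEcard hK
    (fun f hf => (hδ p hpl hpu f).1 hf) fun f hf => (hδ p hpl hpu f).2 hf).trans_eq ?_
  ring

/-- The UNIFORM form (no exceptional layer, `E_δ = ∅`): if eventually in `δ`, for every `c₀ δ ≤ p ≤ p_IK` and EVERY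
face `f`, `|I_f(p)| ≤ C p⁻¹ (δ/p)^θ δ²`, then `InfluenceBoundOn R θ C' c₀ δ` eventually.  (As in the dilute regime,
per-face uniformity is expected to fail near the marked points and along the boundary; use the layered form.) [folklore] -/
theorem influenceBoundOn_of_uniform_influence_bound (R : ConformalRectangle)
    (h : ∃ θ C c₀ : ℝ, 0 < θ ∧ 0 < c₀ ∧ ∀ᶠ δ in 𝓝[>] (0:ℝ), ∀ p : ℝ, c₀ * δ ≤ p → p ≤ pIK →
      ∀ f : Site 2, |influence p R δ f| ≤ C * p⁻¹ * (δ / p) ^ θ * δ ^ 2) :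
    ∃ θ C c₀ : ℝ, 0 < θ ∧ 0 < c₀ ∧ ∀ᶠ δ in 𝓝[>] (0:ℝ), InfluenceBoundOn R θ C c₀ δ := by
  obtain ⟨θ, C, c₀, hθ, hc₀, hev⟩ := h
  refine influenceBoundOn_of_bulk_and_layer_bound R ⟨θ, max C 0, c₀, hθ, hc₀, ?_⟩
  filter_upwards [hev, self_mem_nhdsWithin] with δ hδ hδ0
  refine ⟨∅, by simpa using mul_nonneg (le_max_right C 0) (inv_nonneg.2 (le_of_lt hδ0)), ?_⟩
  intro p hpl hpu f
  have hp : 0 < p := lt_of_lt_of_le (mul_pos hc₀ hδ0) hpl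
  have hK : 0 ≤ p⁻¹ * (δ / p) ^ θ * δ ^ 2 :=
    mul_nonneg (mul_nonneg (inv_nonneg.2 hp.le) (Real.rpow_nonneg (div_nonneg (le_of_lt hδ0) hp.le) _))
      (sq_nonneg δ)
  refine ⟨fun _ => (hδ p hpl hpu f).trans ?_, fun hf => absurd hf (Finset.notMem_empty f)⟩
  simpa only [mul_assoc] using mul_le_mul_of_nonneg_right (le_max_left C 0) hK

/-- ANCHOR (registered sub-goal of stmt-CriticalPhenomena-10964).  The lead's stub `stub_SummedInfluence`,
CONDITIONALLY on the per-face bulk + layer estimate of `influenceBoundOn_of_bulk_and_layer_bound` for every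
conformal rectangle (quantified exactly like the stub's conclusion; the stub's antecedent, the syndrome bias
`SyndromeBiasAt`, is the input of that estimate and is not used by the bookkeeping). [folklore] -/
theorem stub_SummedInfluence_of_bulk_and_layer_bound : (∀ R : ConformalRectangle, ∃ θ C c₀ : ℝ, 0 < θ ∧ 0 < c₀ ∧ ∀ᶠ δ in 𝓝[>] (0:ℝ), ∃ E : Finset (Site 2), (E.card : ℝ) ≤ C * δ⁻¹ ∧ ∀ p : ℝ, c₀ * δ ≤ p → p ≤ pIK → ∀ f : Site 2, (f ∉ E → |influence p R δ f| ≤ C * p⁻¹ * (δ / p) ^ θ * δ ^ 2) ∧ (f ∈ E → |influence p R δ f| ≤ C * p⁻¹ * (δ / p) ^ θ * δ)) → ((∀ p : ℝ, 0 < p → p < 1 → ∃ C : ℝ, SyndromeBiasAt p C) → ∀ R : ConformalRectangle, ∃ θ C c₀ : ℝ, 0 < θ ∧ 0 < c₀ ∧ ∀ᶠ δ in 𝓝[>] (0:ℝ), InfluenceBoundOn R θ C c₀ δ) := by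
  intro h _ R
  exact influenceBoundOn_of_bulk_and_layer_bound R (h R)

end Summit.CriticalPhenomena.CardyFormulaZ2.Theorems.CornerLineDescent.SymmetricSeed
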